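import Summits.NavierStokesRegularity.FluidComputer.PalasekTowerHeredityWitnessWindow
import Summits.NavierStokesRegularity.FluidComputer.PalasekTowerRegisterGlobalViscosity

/-!
# REGISTER v2.3′ at viscosity `ν₀`: the WINDOW form of the base and of the induction (by value, no hypothesis)

Cell `ns-blowup`, seat `ns-blowup-ecbridge-6` (g4; holder of item stmt-NavierStokesRegularity-19179 `EpisodeBase` =
`EpisodeBaseG`). Companion of `PalasekTowerHeredityWitnessWindow.lean` (g3, p433214: one window run from a registered
stage's own state extends the stage — `Stage.exists_extends_of_window_solution`, ANY rates, ANY viscosity `ν > 0`),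
`PalasekTowerHeredityWitnessWindowBase.lean` (g3, p433879: the unit-viscosity base `EpisodeBaseG` in window form) and
`PalasekTowerRegisterGlobalViscosity.lean` (ecbridge-1 g4, p420110: the items of record with the viscosity as a parameter,
`EpisodeBaseGν ν₀` / `EpisodeInductionGν ν₀`, the cell's «Reynolds dial»). LABEL: E–C typing (KERNEL vocabulary: two
equivalences, every implication proved). WHAT THIS IS NOT: not Navier–Stokes evidence — nothing is constructed or
asserted; `EpisodeBaseGν ν₀` and `EpisodeInductionGν ν₀` stay OPEN hypotheses for every `ν₀`; the numbers a design-scoping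
run prints against the right-hand sides (HOME/ecbridge6/PRING1-MEMO.md) are MODEL analogues, never instances.

## What is typed

* `episodeBaseGν_iff_exists_window_solution_zero (hν : 0 < ν₀)` — the base AT VISCOSITY `ν₀` iff some PREPARED HOST at
  `ν₀` (a pinned (`Λ = 8`, `θ = 6/5`), rigid, quiet design on the wide-base rates with a globally anchored registered stage
  `s` at level `0` at viscosity `ν₀`) launches from its own state `s.u (τ₀ − ε)`, some `0 < ε ≤ τ₀`, ONE WINDOW RUN at
  viscosity `ν₀`: a classical solution of the design's forced system on `[τ₀ − ε, τ₁]` with finite energy, below `c₂ Y₁`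
  on `[τ₀, τ₁]`, showing at `τ₁`, in the ball, speed `≥ c₁ Y₁`, gradient `≥ c₁ A₁` and the `N₁`-core loop. At `ν₀ = 1`
  this is p433879's `episodeBaseG_iff_exists_window_solution_zero` (`EpisodeBaseGν 1 = EpisodeBaseG` definitionally).
* `episodeInductionGν_iff_window_solutions (hν : 0 < ν₀)` — the induction AT VISCOSITY `ν₀` iff every registered stage
  at every level `k ≥ 1` of every pinned rigid quiet design admits, for SOME `0 < ε ≤ τ k`, one window run at `ν₀` on
  `[τ k − ε, τ (k+1)]` from its own state with the ceiling and the three floors.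

Why by name: the register's rigid clock `τ (k+1) − τ k = c₅ log N_{k+1} / A_k` and its unit floor constants are NOT
rescaled with the viscosity (`PalasekTowerRegisterGlobalViscosity`, module doc-string), so a window certificate at `ν₀ ≠ 1`
is a statement about a DIFFERENT dynamical problem (core Reynolds numbers `N_k^{β−2}/ν₀`), not a rescaling of the
`ν = 1` one; these two equivalences are the certificate shapes a NAMED design at viscosity `ν₀` would be read against.

References: S. Palasek, arXiv:2605.13827 §3.3–§4 [cite: Palasek2026ElementaryModel, §4]; H. Sohr, *The Navier–Stokes
Equations*, Birkhäuser 2001, Ch. V Thm. 1.5.1 [cite: Sohr2001, Ch. V Thm. 1.5.1].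
-/

noncomputable section

namespace Summit.NavierStokesRegularity.FluidComputer.PalasekTowerClayBridge

open Set MeasureTheory Filter Topology Function Real
open scoped ENNReal ContDiff NNReal
open Literature.Analysis.FluidPDE

/-- **The base at viscosity `ν₀` in WINDOW form — no hypothesis**: `EpisodeBaseGν ν₀` iff some prepared
host at viscosity `ν₀` (pinned rigid quiet wide design with a globally anchored registered level-`0` stage `s`)
launches from its own state `s.u (τ₀ − ε)`, some `0 < ε ≤ τ₀`, one window run at viscosity `ν₀` on `[τ₀ − ε, τ₁]`
with finite energy, below `c₂ Y₁` on `[τ₀, τ₁]`, showing the three level-`1` floors at `τ₁`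
(⇐ `Stage.exists_extends_of_window_solution`; ⇒ restrict the level-`1` stage and read it as its own window run).
[cite: Sohr2001, Ch. V Thm. 1.5.1] -/
theorem episodeBaseGν_iff_exists_window_solution_zero {ν₀ : ℝ} (hν : 0 < ν₀) :
    EpisodeBaseGν ν₀ ↔ ∃ S : Schedule TowerRates.wide, S.Pins 8 (6 / 5) ∧ S.Rigid ∧ S.Quiet ∧
      ∃ s : Stage ν₀ TowerRates.wide S (Margins.routeG TowerRates.wide) 0,
        ∃ ε : ℝ, 0 < ε ∧ ε ≤ S.τ 0 ∧
        ∃ (v : ℝ → EuclideanSpace ℝ (Fin 3) → EuclideanSpace ℝ (Fin 3))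
          (q : ℝ → EuclideanSpace ℝ (Fin 3) → ℝ),
          IsClassicalNSSolutionOn (Icc (S.τ 0 - ε) (S.τ 1)) ν₀ S.f v q ∧
          v (S.τ 0 - ε) = s.u (S.τ 0 - ε) ∧
          (∃ C : ℝ≥0∞, C < ⊤ ∧ ∀ t ∈ Icc (S.τ 0 - ε) (S.τ 1), ∫⁻ x, ‖v t x‖ₑ ^ 2 ≤ C) ∧
          (∀ t ∈ Icc (S.τ 0) (S.τ 1), ∀ x, ‖v t x‖ ≤ S.c₂ * TowerRates.wide.Y 1) ∧
          (∃ x, ‖x‖ ≤ S.radius ∧ S.c₁ * TowerRates.wide.Y 1 ≤ ‖v (S.τ 1) x‖) ∧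
          (∃ x, ‖x‖ ≤ S.radius ∧ S.c₁ * TowerRates.wide.A 1 ≤ ‖fderiv ℝ (v (S.τ 1)) x‖) ∧
          (∃ (x : EuclideanSpace ℝ (Fin 3)) (γ : ℝ → EuclideanSpace ℝ (Fin 3)),
            ‖x‖ ≤ S.radius ∧ ContDiff ℝ 1 γ ∧ γ 0 = γ 1 ∧
            (∀ σ ∈ Icc (0 : ℝ) 1, γ σ ∈ Metric.closedBall x (1 / TowerRates.wide.N 1)) ∧
            (∀ σ ∈ Icc (0 : ℝ) 1, ‖deriv γ σ‖ ≤ 8 * π / TowerRates.wide.N 1) ∧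
            S.c₁ * TowerRates.wide.N 1 ^ (TowerRates.wide.β - 2) ≤ circulation (v (S.τ 1)) γ) := by
  constructor
  · rintro ⟨S, hP, hR, hQ, ⟨s₁⟩⟩
    have hτ : 0 < S.τ 0 := S.τ_pos 0
    set s : Stage ν₀ TowerRates.wide S (Margins.routeG TowerRates.wide) 0 :=
      s₁.restrictOfAntitone (Margins.antitone_routeG TowerRates.wide) (Nat.le_succ 0) with hs
    have hss : s.Extends s₁ :=
      Stage.restrictOfAntitone_extends (Margins.antitone_routeG TowerRates.wide) s₁
    obtain ⟨h1, h2, h3, h4, h5, h6, h7⟩ := Stage.Extends.window_solution s s₁ hss hτ le_rfl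
    exact ⟨S, hP, hR, hQ, s, S.τ 0, hτ, le_rfl, s₁.u, s₁.p, h1, h2, h3, h4, h5, h6, h7⟩
  · rintro ⟨S, hP, hR, hQ, s, ε, hε, hε0, v, q, hcl, h0, henergy, hceil, hfloor, hstrain, hcore⟩
    obtain ⟨s', -⟩ :=
      s.exists_extends_of_window_solution hν hε hε0 hcl h0 henergy hceil hfloor hstrain hcore
    exact ⟨S, hP, hR, hQ, ⟨s'⟩⟩

/-- **The induction at viscosity `ν₀` in WINDOW form — no hypothesis**: `EpisodeInductionGν ν₀` iff every
globally anchored registered stage at every level `k ≥ 1` of every pinned rigid quiet wide design admits, for SOME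
`0 < ε ≤ τ k`, one window run at viscosity `ν₀` on `[τ k − ε, τ (k+1)]` from its own state `s.u (τ k − ε)`:
finite energy, below `c₂ Y_{k+1}` on `[τ k, τ (k+1)]`, the three level-`k+1` floors at `τ (k+1)`
(⇐ `Stage.exists_extends_of_window_solution`; ⇒ `Stage.Extends.window_solution`). [cite: Sohr2001, Ch. V Thm. 1.5.1] -/
theorem episodeInductionGν_iff_window_solutions {ν₀ : ℝ} (hν : 0 < ν₀) :
    EpisodeInductionGν ν₀ ↔ ∀ S : Schedule TowerRates.wide, S.Pins 8 (6 / 5) → S.Rigid → S.Quiet →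
      ∀ k : ℕ, 1 ≤ k → ∀ s : Stage ν₀ TowerRates.wide S (Margins.routeG TowerRates.wide) k,
        ∃ ε : ℝ, 0 < ε ∧ ε ≤ S.τ k ∧
        ∃ (v : ℝ → EuclideanSpace ℝ (Fin 3) → EuclideanSpace ℝ (Fin 3))
          (q : ℝ → EuclideanSpace ℝ (Fin 3) → ℝ),
          IsClassicalNSSolutionOn (Icc (S.τ k - ε) (S.τ (k + 1))) ν₀ S.f v q ∧
          v (S.τ k - ε) = s.u (S.τ k - ε) ∧
          (∃ C : ℝ≥0∞, C < ⊤ ∧ ∀ t ∈ Icc (S.τ k - ε) (S.τ (k + 1)), ∫⁻ x, ‖v t x‖ₑ ^ 2 ≤ C) ∧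
          (∀ t ∈ Icc (S.τ k) (S.τ (k + 1)), ∀ x, ‖v t x‖ ≤ S.c₂ * TowerRates.wide.Y (k + 1)) ∧
          (∃ x, ‖x‖ ≤ S.radius ∧ S.c₁ * TowerRates.wide.Y (k + 1) ≤ ‖v (S.τ (k + 1)) x‖) ∧
          (∃ x, ‖x‖ ≤ S.radius ∧
            S.c₁ * TowerRates.wide.A (k + 1) ≤ ‖fderiv ℝ (v (S.τ (k + 1))) x‖) ∧
          (∃ (x : EuclideanSpace ℝ (Fin 3)) (γ : ℝ → EuclideanSpace ℝ (Fin 3)),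
            ‖x‖ ≤ S.radius ∧ ContDiff ℝ 1 γ ∧ γ 0 = γ 1 ∧
            (∀ σ ∈ Icc (0 : ℝ) 1, γ σ ∈ Metric.closedBall x (1 / TowerRates.wide.N (k + 1))) ∧
            (∀ σ ∈ Icc (0 : ℝ) 1, ‖deriv γ σ‖ ≤ 8 * π / TowerRates.wide.N (k + 1)) ∧
            S.c₁ * TowerRates.wide.N (k + 1) ^ (TowerRates.wide.β - 2) ≤
              circulation (v (S.τ (k + 1))) γ) := by
  constructor
  · intro h S hP hR hQ k hk s
    obtain ⟨s', hss'⟩ := h S hP hR hQ k hk s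
    have hτ : 0 < S.τ k := S.τ_pos k
    obtain ⟨h1, h2, h3, h4, h5, h6, h7⟩ := Stage.Extends.window_solution s s' hss' hτ le_rfl
    exact ⟨S.τ k, hτ, le_rfl, s'.u, s'.p, h1, h2, h3, h4, h5, h6, h7⟩
  · intro h S hP hR hQ k hk s
    obtain ⟨ε, hε, hεk, v, q, hcl, h0, henergy, hceil, hfloor, hstrain, hcore⟩ := h S hP hR hQ k hk s
    exact s.exists_extends_of_window_solution hν hε hεk hcl h0 henergy hceil hfloor hstrain hcore

end Summit.NavierStokesRegularity.FluidComputer.PalasekTowerClayBridge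

end
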